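import Literature.NumberTheory.PAdicHodge.AinfWeierstrassEtaPeriod
import Literature.NumberTheory.PAdicHodge.AinfWeierstrassOmegaPeriodAdd
import Literature.NumberTheory.EllipticCurves.FormalGroupQuasiPeriodAdditionUniversalProofs
import HarnessLib

/-!
# Additivity of the η-period `∫_t η` of the Weierstrass formal group (Banach-free construction)

Topic `Literature/NumberTheory/PAdicHodge`; sequel of `AinfWeierstrassEtaPeriod` (the closed-form, Banach-free η-period
`∫_t η = η₀(T₀) − ι(Σ_{i≥1} p^{i−1} R_p(Tᵢ))` of a `p`-power-compatible sequence `t` of points of `Ŵ(𝔪_{ℂ_F})`) and of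
`AinfWeierstrassOmegaPeriodAdd` (termwise chord–tangent sum `t ⊕ t'` of sequences, `[t ⊕ t'] = [t] ⊕_W [t']`).

Main result **`etaPeriod_addSeq : ∫_{t ⊕ t'} η = ∫_t η + ∫_{t'} η`**. The proof is the integral bookkeeping behind Colmez's
`pⁿη₀(ûₙ ⊕ û'ₙ) − pⁿη₀(ûₙ) − pⁿη₀(û'ₙ) = pⁿ C₀(ûₙ, û'ₙ) → 0`, rewritten for the closed form:

* §1 an INTEGRAL addition cocycle `C = cocycleInt W ∈ ℤ⟦u,v⟧` (`C ⊗ ℚ = C₀ = η₀(u ⊕ v) − η₀(u) − η₀(v)`) and the integral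
  coboundary identity `R_n(u ⊕ v) − R_n(u) − R_n(v) = C([n]u,[n]v) − n·C(u,v)` (`mulDefectInt_cocycle`, transported from
  `formalQuasiPeriodMulDefect_cocycle` over `ℚ` by injectivity of `ℤ⟦u,v⟧ → ℚ⟦u,v⟧`);
* §2 its evaluation in `𝔸_inf`: `R_n(a ⊕ b) − R_n(a) − R_n(b) = C([n]a,[n]b) − n·C(a,b)` for `a, b ∈ 𝔫` (`mulDefect_addW`);
* §3 with `Dᵢ := C(Tᵢ, T'ᵢ)` and `[p]T_{i+1} = Tᵢ`: `R_p(T_{i+1} ⊕ T'_{i+1}) − R_p(T_{i+1}) − R_p(T'_{i+1}) = Dᵢ − pD_{i+1}`, the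
  partial sums telescope to `D₀ − pⁿDₙ`, and `pⁿDₙ → 0` `(p,ξ)`-adically: **`corr(t ⊕ t') − corr t − corr t' = D₀ = C(T₀,T'₀)`**;
* §4 the main term: `η₀(T₀ ⊕ T'₀) = η₀(T₀) + η₀(T'₀) + ι(C(T₀,T'₀))` (evaluation of `η₀ ∘ F = η₀(u) + η₀(v) + C` on `Fil¹B_dR⁺`,
  the cocycle term being integral hence coming from `𝔸_inf`), so the two copies of `C(T₀, T'₀)` cancel: **`etaPeriod_addSeq`**.

BSD context: crux K★ `stmt-BirchSwinnertonDyer-22226`, hDR sector (iii) road (A): `t ↦ ∫_t η` is the second coordinate of the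
de Rham comparison map of `V_pŴ`; additivity is what makes it a homomorphism on the Tate module. BSD is not proved by any of this.

## References
* P. Colmez, *Périodes p-adiques des variétés abéliennes*, Math. Ann. 292 (1992), §2. [Colmez1992PeriodesAbeliennes]
* N. M. Katz, *Crystalline cohomology, Dieudonné modules, and Jacobi sums* (1981), §5.1. [Katz1981CrystallineDieudonne]
* J.-M. Fontaine, *Le corps des périodes p-adiques*, Astérisque 223 (1994), Exp. II §1.2, §1.5. [FontaineAsterisque223III]
-/

noncomputable section

open Ideal Filter Topology Field WittVector MvPowerSeries

namespace Literature.NumberTheory.PAdicHodge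

open Literature.NumberTheory.GaloisRepresentations
open Literature.NumberTheory.GaloisRepresentations.IsNonarchimedeanLocalField
open Literature.NumberTheory.GaloisRepresentations.LubinTate

namespace AinfTop

variable {F : Type} [Field F] [ValuativeRel F] [TopologicalSpace F] [IsNonarchimedeanLocalField F] [CharZero F]
  {p : ℕ} [Fact p.Prime] [Fact (¬ IsUnit (p : integerC F))]
  [IsAdicComplete (Ideal.span {(p : integerC F)}) (integerC F)]
  {hθ : Function.Surjective (fontaineTheta (integerC F) p)}
  (W : WeierstrassCurve ℤ)

/-! ## §1 An integral addition cocycle and the integral coboundary identity -/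

/-- **An integral addition cocycle `C ∈ ℤ⟦u, v⟧`** of `η₀` (`C ↦ C₀ = η₀(u ⊕ v) − η₀(u) − η₀(v)` in `ℚ⟦u, v⟧`;
`exists_map_eq_formalQuasiPeriodCocycle` along `ℤ ↪ ℚ`). [cite: Katz1981CrystallineDieudonne, §5.1] -/
def cocycleInt (W : WeierstrassCurve ℤ) : MvPowerSeries (Fin 2) ℤ :=
  Classical.choose (W.exists_map_eq_formalQuasiPeriodCocycle (φ := Int.castRingHom ℚ) Int.cast_injective)

omit [CharZero F] [Fact p.Prime] [Fact (¬ IsUnit (p : integerC F))]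
  [IsAdicComplete (Ideal.span {(p : integerC F)}) (integerC F)] in
/-- `C ⊗ ℚ = C₀`. [cite: Katz1981CrystallineDieudonne, §5.1] -/
theorem map_cocycleInt :
    MvPowerSeries.map (Int.castRingHom ℚ) (cocycleInt W) = (W.map (Int.castRingHom ℚ)).formalQuasiPeriodCocycle :=
  Classical.choose_spec (W.exists_map_eq_formalQuasiPeriodCocycle (φ := Int.castRingHom ℚ) Int.cast_injective)

omit [CharZero F] [Fact p.Prime] [Fact (¬ IsUnit (p : integerC F))]
  [IsAdicComplete (Ideal.span {(p : integerC F)}) (integerC F)] in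
/-- `C(0, 0) = 0`. [cite: Katz1981CrystallineDieudonne, §5.1] -/
theorem constantCoeff_cocycleInt : MvPowerSeries.constantCoeff (cocycleInt W) = 0 := by
  apply Int.cast_injective (α := ℚ)
  have h := congrArg MvPowerSeries.constantCoeff (map_cocycleInt W)
  rw [MvPowerSeries.constantCoeff_map, eq_intCast] at h
  rw [Int.cast_zero, h, WeierstrassCurve.constantCoeff_formalQuasiPeriodCocycle]

omit [CharZero F] [Fact p.Prime] [Fact (¬ IsUnit (p : integerC F))]
  [IsAdicComplete (Ideal.span {(p : integerC F)}) (integerC F)] in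
/-- **The integral coboundary identity** `R_n(u ⊕ v) − R_n(u) − R_n(v) = C([n]u, [n]v) − n·C(u, v)` in `ℤ⟦u, v⟧`
(from `formalQuasiPeriodMulDefect_cocycle` over `ℚ`, by injectivity of `ℤ⟦u,v⟧ → ℚ⟦u,v⟧`). [cite: Katz1981CrystallineDieudonne, §5.1] -/
theorem mulDefectInt_cocycle (n : ℕ) :
    (mulDefectInt W n).subst W.formalGroupLaw -
        (mulDefectInt W n).subst (MvPowerSeries.X 0 : MvPowerSeries (Fin 2) ℤ) -
        (mulDefectInt W n).subst (MvPowerSeries.X 1 : MvPowerSeries (Fin 2) ℤ) =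
      MvPowerSeries.subst ![(W.formalMul n).subst (MvPowerSeries.X 0 : MvPowerSeries (Fin 2) ℤ),
          (W.formalMul n).subst (MvPowerSeries.X 1 : MvPowerSeries (Fin 2) ℤ)] (cocycleInt W) -
        (n : MvPowerSeries (Fin 2) ℤ) * cocycleInt W := by
  apply WeierstrassCurve.mvPowerSeries_map_injective (φ := Int.castRingHom ℚ) Int.cast_injective
  have hn0 := W.constantCoeff_formalMul n
  have h0 : MvPowerSeries.constantCoeff ((W.formalMul n).subst (MvPowerSeries.X 0 : MvPowerSeries (Fin 2) ℤ)) = 0 :=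
    Literature.NumberTheory.EllipticCurves.constantCoeff_powerSeries_subst_eq_zero (MvPowerSeries.constantCoeff_X 0) hn0
  have h1 : MvPowerSeries.constantCoeff ((W.formalMul n).subst (MvPowerSeries.X 1 : MvPowerSeries (Fin 2) ℤ)) = 0 :=
    Literature.NumberTheory.EllipticCurves.constantCoeff_powerSeries_subst_eq_zero (MvPowerSeries.constantCoeff_X 1) hn0
  have key := (W.map (Int.castRingHom ℚ)).formalQuasiPeriodMulDefect_cocycle n
  rw [map_sub, map_sub, map_sub, map_mul, map_natCast, PowerSeries.map_subst W.hasSubst_formalGroupLaw,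
    PowerSeries.map_subst (PowerSeries.HasSubst.X 0), PowerSeries.map_subst (PowerSeries.HasSubst.X 1),
    MvPowerSeries.map_subst (WeierstrassCurve.hasSubst_pair h0 h1), map_mulDefectInt, map_cocycleInt, WeierstrassCurve.map_formalGroupLaw,
    MvPowerSeries.map_X, MvPowerSeries.map_X]
  convert key using 3
  funext i
  fin_cases i
  · show MvPowerSeries.map (Int.castRingHom ℚ) ((W.formalMul n).subst (MvPowerSeries.X 0 : MvPowerSeries (Fin 2) ℤ)) = _
    rw [PowerSeries.map_subst (PowerSeries.HasSubst.X 0), WeierstrassCurve.map_formalMul, MvPowerSeries.map_X]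
    rfl
  · show MvPowerSeries.map (Int.castRingHom ℚ) ((W.formalMul n).subst (MvPowerSeries.X 1 : MvPowerSeries (Fin 2) ℤ)) = _
    rw [PowerSeries.map_subst (PowerSeries.HasSubst.X 1), WeierstrassCurve.map_formalMul, MvPowerSeries.map_X]
    rfl

/-! ## §2 The cocycle evaluated in `𝔸_inf`, and additivity of the correction -/

/-- `C(a, b) ∈ 𝔸_inf` for points `a, b ∈ 𝔫`. [cite: Katz1981CrystallineDieudonne, §5.1] -/
def cocycleAt (hθ : Function.Surjective (fontaineTheta (integerC F) p)) (a b : (nilTheta F p hθ).toIdeal) : AinfTop F p :=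
  (evalPt (nilTheta F p hθ) (cocycleInt W) (constantCoeff_cocycleInt W) ![a, b] : AinfTop F p)

/-- **The coboundary identity at points**: `R_n(a ⊕_W b) − R_n(a) − R_n(b) = C([n]a, [n]b) − n·C(a, b)` in `𝔸_inf` for
`a, b ∈ 𝔫` (evaluate `mulDefectInt_cocycle`). [cite: Katz1981CrystallineDieudonne, §5.1] -/
theorem mulDefect_addW (n : ℕ) (a b : (nilTheta F p hθ).toIdeal) :
    (evalPt₁ (nilTheta F p hθ) (mulDefectInt W n) (constantCoeff_mulDefectInt W n) (addW W a b) : AinfTop F p) -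
        evalPt₁ (nilTheta F p hθ) (mulDefectInt W n) (constantCoeff_mulDefectInt W n) a -
        evalPt₁ (nilTheta F p hθ) (mulDefectInt W n) (constantCoeff_mulDefectInt W n) b =
      cocycleAt W hθ (evalPt₁ (nilTheta F p hθ) (W.formalMul n) (W.constantCoeff_formalMul n) a)
          (evalPt₁ (nilTheta F p hθ) (W.formalMul n) (W.constantCoeff_formalMul n) b) -
        (n : AinfTop F p) * cocycleAt W hθ a b := by
  have hx := (nilTheta F p hθ).hasEval ![a, b]
  have h := congrArg (MvPowerSeries.aeval (R := ℤ) hx) (mulDefectInt_cocycle W n)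
  simp only [map_sub, map_mul, map_natCast] at h
  have hn0 := W.constantCoeff_formalMul n
  have hR0 := constantCoeff_mulDefectInt W n
  -- identify each evaluated piece
  have e1 : MvPowerSeries.aeval hx ((mulDefectInt W n).subst W.formalGroupLaw) =
      (evalPt₁ (nilTheta F p hθ) (mulDefectInt W n) hR0 (addW W a b) : AinfTop F p) := by
    rw [addW, ← evalPt₁_subst (nilTheta F p hθ) W.formalGroupLaw W.constantCoeff_formalGroupLaw (mulDefectInt W n) hR0
      (Literature.NumberTheory.EllipticCurves.constantCoeff_powerSeries_subst_eq_zero W.constantCoeff_formalGroupLaw hR0)]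
    rfl
  have eX : ∀ (i : Fin 2), MvPowerSeries.aeval hx ((mulDefectInt W n).subst (MvPowerSeries.X i : MvPowerSeries (Fin 2) ℤ)) =
      (evalPt₁ (nilTheta F p hθ) (mulDefectInt W n) hR0 (![a, b] i) : AinfTop F p) := fun i => by
    rw [← evalPt_X (nilTheta F p hθ) (A := ℤ) i ![a, b],
      ← evalPt₁_subst (nilTheta F p hθ) (MvPowerSeries.X i) (MvPowerSeries.constantCoeff_X i) (mulDefectInt W n) hR0
        (Literature.NumberTheory.EllipticCurves.constantCoeff_powerSeries_subst_eq_zero (MvPowerSeries.constantCoeff_X i) hR0)]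
    rfl
  have hfam0 : ∀ s, MvPowerSeries.constantCoeff ((![(W.formalMul n).subst (MvPowerSeries.X 0 : MvPowerSeries (Fin 2) ℤ),
      (W.formalMul n).subst (MvPowerSeries.X 1 : MvPowerSeries (Fin 2) ℤ)]) s) = 0 := fun s => by
    fin_cases s
    · exact Literature.NumberTheory.EllipticCurves.constantCoeff_powerSeries_subst_eq_zero (MvPowerSeries.constantCoeff_X 0) hn0
    · exact Literature.NumberTheory.EllipticCurves.constantCoeff_powerSeries_subst_eq_zero (MvPowerSeries.constantCoeff_X 1) hn0
  have hfa : MvPowerSeries.constantCoeff (MvPowerSeries.subst ![(W.formalMul n).subst (MvPowerSeries.X 0 : MvPowerSeries (Fin 2) ℤ),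
      (W.formalMul n).subst (MvPowerSeries.X 1 : MvPowerSeries (Fin 2) ℤ)] (cocycleInt W)) = 0 :=
    MvPowerSeries.constantCoeff_subst_eq_zero (MvPowerSeries.hasSubst_of_constantCoeff_zero hfam0) hfam0
      (constantCoeff_cocycleInt W)
  have hmul : ∀ (i : Fin 2) (hc : MvPowerSeries.constantCoeff ((W.formalMul n).subst (MvPowerSeries.X i : MvPowerSeries (Fin 2) ℤ)) = 0),
      evalPt (nilTheta F p hθ) ((W.formalMul n).subst (MvPowerSeries.X i : MvPowerSeries (Fin 2) ℤ)) hc ![a, b] =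
        evalPt₁ (nilTheta F p hθ) (W.formalMul n) hn0 (![a, b] i) := fun i hc => by
    rw [evalPt₁_subst (nilTheta F p hθ) (MvPowerSeries.X i) (MvPowerSeries.constantCoeff_X i) (W.formalMul n) hn0 hc, evalPt_X]
  have e3 : MvPowerSeries.aeval hx (MvPowerSeries.subst ![(W.formalMul n).subst (MvPowerSeries.X 0 : MvPowerSeries (Fin 2) ℤ),
      (W.formalMul n).subst (MvPowerSeries.X 1 : MvPowerSeries (Fin 2) ℤ)] (cocycleInt W)) =
      cocycleAt W hθ (evalPt₁ (nilTheta F p hθ) (W.formalMul n) hn0 a) (evalPt₁ (nilTheta F p hθ) (W.formalMul n) hn0 b) := by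
    rw [cocycleAt, ← coe_evalPt (nilTheta F p hθ) _ hfa ![a, b],
      evalPt_subst (nilTheta F p hθ) hfam0 (cocycleInt W) (constantCoeff_cocycleInt W) hfa ![a, b]]
    have hfun : (fun s => evalPt (nilTheta F p hθ) ((![(W.formalMul n).subst (MvPowerSeries.X 0 : MvPowerSeries (Fin 2) ℤ),
        (W.formalMul n).subst (MvPowerSeries.X 1 : MvPowerSeries (Fin 2) ℤ)]) s) (hfam0 s) ![a, b]) =
        ![evalPt₁ (nilTheta F p hθ) (W.formalMul n) hn0 a, evalPt₁ (nilTheta F p hθ) (W.formalMul n) hn0 b] := by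
      funext s
      fin_cases s
      · exact hmul 0 _
      · exact hmul 1 _
    rw [hfun]
  have e4 : MvPowerSeries.aeval hx (cocycleInt W) = cocycleAt W hθ a b := rfl
  rw [e1, eX 0, eX 1, e3, e4] at h
  exact h

end AinfTop

end Literature.NumberTheory.PAdicHodge

namespace Literature.NumberTheory.PAdicHodge

open Literature.NumberTheory.GaloisRepresentations
open Literature.NumberTheory.GaloisRepresentations.IsNonarchimedeanLocalField
open Literature.NumberTheory.GaloisRepresentations.LubinTate

namespace AinfTop

variable {F : Type} [Field F] [ValuativeRel F] [TopologicalSpace F] [IsNonarchimedeanLocalField F] [CharZero F]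
  {p : ℕ} [Fact p.Prime] [Fact (¬ IsUnit (p : integerC F))]
  [IsAdicComplete (Ideal.span {(p : integerC F)}) (integerC F)]
  {hθ : Function.Surjective (fontaineTheta (integerC F) p)}
  (W : WeierstrassCurve ℤ)

/-! ## §3 Additivity of the correction: `corr(t ⊕ t') = corr t + corr t' + C(T₀, T₀')` -/

/-- `Tᵢ(t ⊕ t') = Tᵢ(t) ⊕_W Tᵢ(t')` (Fontaine's element of a termwise sum, shifted). [cite: FontaineAsterisque223III, Exp. II §1.2.2] -/
theorem torsionLiftShiftPt_addSeq {t t' : ℕ → (maxNilIdealC F).toIdeal} (htp : ∀ n, mulPC F p W (t (n + 1)) = t n)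
    (htp' : ∀ n, mulPC F p W (t' (n + 1)) = t' n) (i : ℕ) :
    torsionLiftShiftPt W hθ (addSeq F W t t') (mulPC_addSeq W htp htp') i =
      addW W (torsionLiftShiftPt W hθ t htp i) (torsionLiftShiftPt W hθ t' htp' i) := by
  apply Subtype.ext
  rw [coe_torsionLiftShiftPt, torsionLiftShift]
  exact torsionLift_addSeq W (shiftSeq_compat W htp i) (shiftSeq_compat W htp' i)

/-- The cocycle along the two towers: `Dᵢ = C(Tᵢ, T'ᵢ)`. [cite: Katz1981CrystallineDieudonne, §5.1] -/
def cocycleShift (hθ : Function.Surjective (fontaineTheta (integerC F) p)) (t t' : ℕ → (maxNilIdealC F).toIdeal)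
    (htp : ∀ n, mulPC F p W (t (n + 1)) = t n) (htp' : ∀ n, mulPC F p W (t' (n + 1)) = t' n) (i : ℕ) : AinfTop F p :=
  cocycleAt W hθ (torsionLiftShiftPt W hθ t htp i) (torsionLiftShiftPt W hθ t' htp' i)

/-- **`R_p(T_{i+1} ⊕ T'_{i+1}) − R_p(T_{i+1}) − R_p(T'_{i+1}) = Dᵢ − p·D_{i+1}`.** [cite: Katz1981CrystallineDieudonne, §5.1] -/
theorem mulDefectAt_addSeq {t t' : ℕ → (maxNilIdealC F).toIdeal} (htp : ∀ n, mulPC F p W (t (n + 1)) = t n)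
    (htp' : ∀ n, mulPC F p W (t' (n + 1)) = t' n) (i : ℕ) :
    mulDefectAt W hθ (addSeq F W t t') (mulPC_addSeq W htp htp') (i + 1) - mulDefectAt W hθ t htp (i + 1) -
        mulDefectAt W hθ t' htp' (i + 1) =
      cocycleShift W hθ t t' htp htp' i - (p : AinfTop F p) * cocycleShift W hθ t t' htp htp' (i + 1) := by
  rw [mulDefectAt, mulDefectAt, mulDefectAt, torsionLiftShiftPt_addSeq W htp htp' (i + 1), mulDefect_addW W p,
    cocycleShift, cocycleShift]
  congr 2
  · exact Subtype.ext (mulP_torsionLiftShiftPt W htp i)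
  · exact Subtype.ext (mulP_torsionLiftShiftPt W htp' i)

/-- Telescoping: `S_n(t ⊕ t') − S_n(t) − S_n(t') = D₀ − pⁿ·D_n`. [cite: Colmez1992PeriodesAbeliennes, §2] -/
theorem etaCorrPartial_addSeq {t t' : ℕ → (maxNilIdealC F).toIdeal} (htp : ∀ n, mulPC F p W (t (n + 1)) = t n)
    (htp' : ∀ n, mulPC F p W (t' (n + 1)) = t' n) (n : ℕ) :
    etaCorrPartial W hθ (addSeq F W t t') (mulPC_addSeq W htp htp') n - etaCorrPartial W hθ t htp n - etaCorrPartial W hθ t' htp' n =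
      cocycleShift W hθ t t' htp htp' 0 - (p : AinfTop F p) ^ n * cocycleShift W hθ t t' htp htp' n := by
  induction n with
  | zero => simp [etaCorrPartial]
  | succ n ih =>
    have h := mulDefectAt_addSeq W (hθ := hθ) htp htp' n
    simp only [etaCorrPartial, Finset.sum_range_succ] at ih ⊢
    linear_combination ih + (p : AinfTop F p) ^ n * h

/-- **Additivity of the correction up to the cocycle: `corr(t ⊕ t') = corr t + corr t' + C(T₀, T'₀)`.**
[cite: Colmez1992PeriodesAbeliennes, §2] -/
theorem etaCorr_addSeq {t t' : ℕ → (maxNilIdealC F).toIdeal} (htp : ∀ n, mulPC F p W (t (n + 1)) = t n)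
    (htp' : ∀ n, mulPC F p W (t' (n + 1)) = t' n) :
    etaCorr W hθ (addSeq F W t t') (mulPC_addSeq W htp htp') - etaCorr W hθ t htp - etaCorr W hθ t' htp' =
      cocycleShift W hθ t t' htp htp' 0 := by
  have h1 : Tendsto (fun n => etaCorrPartial W hθ (addSeq F W t t') (mulPC_addSeq W htp htp') (n + 1) -
      etaCorrPartial W hθ t htp (n + 1) - etaCorrPartial W hθ t' htp' (n + 1)) atTop
      (𝓝 (etaCorr W hθ (addSeq F W t t') (mulPC_addSeq W htp htp') - etaCorr W hθ t htp - etaCorr W hθ t' htp')) :=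
    ((tendsto_etaCorrPartial W (mulPC_addSeq W htp htp')).sub (tendsto_etaCorrPartial W htp)).sub (tendsto_etaCorrPartial W htp')
  have h2 : Tendsto (fun n => etaCorrPartial W hθ (addSeq F W t t') (mulPC_addSeq W htp htp') (n + 1) -
      etaCorrPartial W hθ t htp (n + 1) - etaCorrPartial W hθ t' htp' (n + 1)) atTop (𝓝 (cocycleShift W hθ t t' htp htp' 0)) := by
    refine tendsto_of_forall_sub_mem_pow fun n => ?_
    rw [etaCorrPartial_addSeq W htp htp' (n + 1), sub_sub_cancel]
    refine Ideal.mul_mem_right _ _ (Ideal.pow_mem_pow ?_ _)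
    rw [ideal_eq]
    exact Ideal.subset_span (by simp)
  exact tendsto_nhds_unique h1 h2

/-! ## §4 Additivity of the main term and of the η-period -/

omit [CharZero F] [Fact p.Prime] [Fact (¬ IsUnit (p : integerC F))] [IsAdicComplete (Ideal.span {(p : integerC F)}) (integerC F)] in
/-- `η₀` over `RatCoeff` is the quasi-period function of the base-changed equation. [cite: Katz1981CrystallineDieudonne, §5.1] -/
theorem etaSeries_eq_formalQuasiPeriod : etaSeries W = (W.map (Int.castRingHom RatCoeff)).formalQuasiPeriod := by
  have h : RatCoeff.of.toRingHom.comp (Int.castRingHom ℚ) = Int.castRingHom RatCoeff := RingHom.ext_int _ _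
  rw [etaSeries, WeierstrassCurve.map_formalQuasiPeriod, WeierstrassCurve.map_map, ← h]

omit [CharZero F] [Fact p.Prime] [Fact (¬ IsUnit (p : integerC F))] [IsAdicComplete (Ideal.span {(p : integerC F)}) (integerC F)] in
/-- The integral cocycle base-changed to `RatCoeff` is the cocycle of the base-changed equation.
[cite: Katz1981CrystallineDieudonne, §5.1] -/
theorem map_cocycleInt_ratCoeff :
    MvPowerSeries.map (Int.castRingHom RatCoeff) (cocycleInt W) = (W.map (Int.castRingHom RatCoeff)).formalQuasiPeriodCocycle := by
  have h : RatCoeff.of.toRingHom.comp (Int.castRingHom ℚ) = Int.castRingHom RatCoeff := RingHom.ext_int _ _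
  rw [← h, MvPowerSeries.map_comp, RingHom.comp_apply, map_cocycleInt, WeierstrassCurve.map_formalQuasiPeriodCocycle,
    WeierstrassCurve.map_map]

omit [CharZero F] [Fact p.Prime] [Fact (¬ IsUnit (p : integerC F))] [IsAdicComplete (Ideal.span {(p : integerC F)}) (integerC F)] in
/-- `η₀(u ⊕ v) = η₀(u) + η₀(v) + C₀(u, v)` (the definition of the cocycle, rearranged). [cite: Katz1981CrystallineDieudonne, §5.1] -/
theorem formalQuasiPeriod_subst_formalGroupLaw_eq {A : Type*} [CommRing A] [Algebra ℚ A] (V : WeierstrassCurve A) :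
    V.formalQuasiPeriod.subst V.formalGroupLaw =
      V.formalQuasiPeriod.subst (MvPowerSeries.X 0 : MvPowerSeries (Fin 2) A) +
        V.formalQuasiPeriod.subst (MvPowerSeries.X 1 : MvPowerSeries (Fin 2) A) + V.formalQuasiPeriodCocycle := by
  rw [WeierstrassCurve.formalQuasiPeriodCocycle_def]
  ring

/-- **The cocycle term of the main term comes from `𝔸_inf`**: `C₀(T, T') = ι(C(T₀, T'₀))` in `B_dR⁺`, where `T = [t], T' = [t']`
read in `Fil¹` and `T₀, T'₀` the same elements read in `𝔫 ⊂ 𝔸_inf`. [cite: FontaineAsterisque223III, Exp. II §1.5.2] -/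
theorem evalPt_cocycle_eq_ofAinf {t t' : ℕ → (maxNilIdealC F).toIdeal} (ht0 : (t 0 : CBall F) = 0)
    (ht0' : (t' 0 : CBall F) = 0) (htp : ∀ n, mulPC F p W (t (n + 1)) = t n) (htp' : ∀ n, mulPC F p W (t' (n + 1)) = t' n) :
    (evalPt (BdRPlusTop.filOne F p) (W.map (Int.castRingHom RatCoeff)).formalQuasiPeriodCocycle
        (W.map (Int.castRingHom RatCoeff)).constantCoeff_formalQuasiPeriodCocycle
        ![torsionLiftFil W hθ t ht0 htp, torsionLiftFil W hθ t' ht0' htp'] : BdRPlusTop F p) =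
      BdRPlusTop.ofAinf F p ((of F p).symm (cocycleShift W hθ t t' htp htp' 0)) := by
  have hCint : (MvPowerSeries.map (Int.castRingHom RatCoeff) (cocycleInt W)).constantCoeff = 0 :=
    BdRPlusTop.constantCoeff_map_int_eq_zero (constantCoeff_cocycleInt W)
  rw [← congrArg Subtype.val (evalPt_congr (BdRPlusTop.filOne F p) (map_cocycleInt_ratCoeff W) hCint
      (W.map (Int.castRingHom RatCoeff)).constantCoeff_formalQuasiPeriodCocycle
      ![torsionLiftFil W hθ t ht0 htp, torsionLiftFil W hθ t' ht0' htp']),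
    ← BdRPlusTop.evalPt_map_int _ (constantCoeff_cocycleInt W) hCint, cocycleShift, cocycleAt]
  symm
  exact AinfXiTop.ofAinf_evalPt (cocycleInt W) (constantCoeff_cocycleInt W) _
    (fun i => by
      fin_cases i
      · exact torsionLift_mem_span_xi W ht0 htp
      · exact torsionLift_mem_span_xi W ht0' htp')
    _ (fun i => by fin_cases i <;> rfl)

/-- **Additivity of the main term up to the cocycle: `η₀([t ⊕ t']) = η₀([t]) + η₀([t']) + ι(C(T₀, T'₀))`** (`η₀ ∘ F =
η₀(u) + η₀(v) + C₀` evaluated `ξ`-adically at `([t], [t'])`, `[t ⊕ t'] = [t] ⊕_W [t']`, and the cocycle term is integral).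
[cite: Colmez1992PeriodesAbeliennes, §2] [cite: Katz1981CrystallineDieudonne, §5.1] -/
theorem etaPeriodMain_addSeq {t t' : ℕ → (maxNilIdealC F).toIdeal} (ht0 : (t 0 : CBall F) = 0)
    (ht0' : (t' 0 : CBall F) = 0) (htp : ∀ n, mulPC F p W (t (n + 1)) = t n) (htp' : ∀ n, mulPC F p W (t' (n + 1)) = t' n) :
    etaPeriodMain W hθ (addSeq F W t t') (coe_addSeq_zero W ht0 ht0') (mulPC_addSeq W htp htp') =
      etaPeriodMain W hθ t ht0 htp + etaPeriodMain W hθ t' ht0' htp' +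
        BdRPlusTop.ofAinf F p ((of F p).symm (cocycleShift W hθ t t' htp htp' 0)) := by
  set V := W.map (Int.castRingHom RatCoeff) with hV
  set T := torsionLiftFil W hθ t ht0 htp
  set T' := torsionLiftFil W hθ t' ht0' htp'
  have hFq : (MvPowerSeries.map (Int.castRingHom RatCoeff) W.formalGroupLaw).constantCoeff = 0 :=
    BdRPlusTop.constantCoeff_map_int_eq_zero W.constantCoeff_formalGroupLaw
  -- the point `[t ⊕ t']` of `Fil¹` is `F_ℚ(T, T')`
  have hpt : torsionLiftFil W hθ (addSeq F W t t') (coe_addSeq_zero W ht0 ht0') (mulPC_addSeq W htp htp') =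
      evalPt (BdRPlusTop.filOne F p) V.formalGroupLaw V.constantCoeff_formalGroupLaw ![T, T'] := by
    apply Subtype.ext
    rw [coe_torsionLiftFil_addSeq W ht0 ht0' htp htp', BdRPlusTop.evalPt_map_int _ _ hFq]
    exact congrArg Subtype.val (evalPt_congr (BdRPlusTop.filOne F p) (map_formalGroupLaw_ratCoeff W) hFq
      V.constantCoeff_formalGroupLaw ![T, T'])
  have hη0 : PowerSeries.constantCoeff V.formalQuasiPeriod = 0 := V.constantCoeff_formalQuasiPeriod
  have hC0 : V.formalQuasiPeriodCocycle.constantCoeff = 0 := V.constantCoeff_formalQuasiPeriodCocycle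
  have hsub0 : (V.formalQuasiPeriod.subst V.formalGroupLaw).constantCoeff = 0 :=
    constantCoeff_subst_zero (σ := Unit) (fun _ => V.constantCoeff_formalGroupLaw) hη0
  have hX0 : ∀ i : Fin 2, (V.formalQuasiPeriod.subst (MvPowerSeries.X i : MvPowerSeries (Fin 2) RatCoeff)).constantCoeff = 0 :=
    fun i => constantCoeff_subst_zero (σ := Unit) (fun _ => MvPowerSeries.constantCoeff_X i) hη0
  have hsum0 : (V.formalQuasiPeriod.subst (MvPowerSeries.X 0 : MvPowerSeries (Fin 2) RatCoeff) +
      V.formalQuasiPeriod.subst (MvPowerSeries.X 1 : MvPowerSeries (Fin 2) RatCoeff) + V.formalQuasiPeriodCocycle).constantCoeff = 0 := by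
    rw [map_add, map_add, hX0 0, hX0 1, hC0, add_zero, add_zero]
  have hcoc : (evalPt (BdRPlusTop.filOne F p) V.formalQuasiPeriodCocycle hC0 ![T, T'] : BdRPlusTop F p) =
      BdRPlusTop.ofAinf F p ((of F p).symm (cocycleShift W hθ t t' htp htp' 0)) :=
    evalPt_cocycle_eq_ofAinf W ht0 ht0' htp htp'
  rw [etaPeriodMain, etaPeriodMain, etaPeriodMain, hpt]
  have hl : ∀ (x : (BdRPlusTop.filOne F p).toIdeal),
      (evalPt₁ (BdRPlusTop.filOne F p) (etaSeries W) (constantCoeff_etaSeries W) x : BdRPlusTop F p) =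
        evalPt₁ (BdRPlusTop.filOne F p) V.formalQuasiPeriod hη0 x := fun x =>
    congrArg Subtype.val (evalPt_congr (BdRPlusTop.filOne F p) (ι := Unit) (etaSeries_eq_formalQuasiPeriod W)
      (constantCoeff_etaSeries W) hη0 fun _ => x)
  rw [hl, hl, hl, ← evalPt₁_subst (BdRPlusTop.filOne F p) V.formalGroupLaw V.constantCoeff_formalGroupLaw V.formalQuasiPeriod hη0 hsub0,
    evalPt_congr (BdRPlusTop.filOne F p) (formalQuasiPeriod_subst_formalGroupLaw_eq V) hsub0 hsum0 ![T, T'], coe_evalPt, map_add,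
    map_add, ← coe_evalPt (BdRPlusTop.filOne F p) _ (hX0 0), ← coe_evalPt (BdRPlusTop.filOne F p) _ (hX0 1),
    ← coe_evalPt (BdRPlusTop.filOne F p) _ hC0,
    evalPt₁_subst (BdRPlusTop.filOne F p) (MvPowerSeries.X 0 : MvPowerSeries (Fin 2) RatCoeff) (MvPowerSeries.constantCoeff_X 0)
      V.formalQuasiPeriod hη0 (hX0 0),
    evalPt₁_subst (BdRPlusTop.filOne F p) (MvPowerSeries.X 1 : MvPowerSeries (Fin 2) RatCoeff) (MvPowerSeries.constantCoeff_X 1)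
      V.formalQuasiPeriod hη0 (hX0 1), evalPt_X, evalPt_X, hcoc]
  rfl

/-- **Additivity of the η-period: `∫_{t ⊕ t'} η = ∫_t η + ∫_{t'} η` in `B_dR⁺(F)`** for `[p]`-compatible torsion sequences `t, t'`
of `Ŵ(𝔪_{ℂ_F})` (Colmez 1992 §2: `t ↦ ∫_t η` is a homomorphism on the Tate module; here for the Banach-free closed form
`η₀([t]) − ι(Σ p^{i−1}R_p(Tᵢ))`, the two cocycle contributions `C(T₀, T'₀)` of the main term and of the correction cancel).
[cite: Colmez1992PeriodesAbeliennes, §2] -/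
theorem etaPeriod_addSeq {t t' : ℕ → (maxNilIdealC F).toIdeal} (ht0 : (t 0 : CBall F) = 0)
    (ht0' : (t' 0 : CBall F) = 0) (htp : ∀ n, mulPC F p W (t (n + 1)) = t n) (htp' : ∀ n, mulPC F p W (t' (n + 1)) = t' n) :
    etaPeriod W hθ (addSeq F W t t') (coe_addSeq_zero W ht0 ht0') (mulPC_addSeq W htp htp') =
      etaPeriod W hθ t ht0 htp + etaPeriod W hθ t' ht0' htp' := by
  have hc : etaCorr W hθ (addSeq F W t t') (mulPC_addSeq W htp htp') =
      etaCorr W hθ t htp + etaCorr W hθ t' htp' + cocycleShift W hθ t t' htp htp' 0 := by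
    rw [← etaCorr_addSeq W htp htp']
    ring
  rw [etaPeriod, etaPeriod, etaPeriod, etaPeriodMain_addSeq W ht0 ht0' htp htp', hc, map_add, map_add, map_add, map_add]
  ring

end AinfTop

end Literature.NumberTheory.PAdicHodge

end
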